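import Literature.Analysis.Complex.CrossTheoremThreeStrips
import Literature.Analysis.Complex.LocalCrossTheorem
import HarnessLib

/-!
# The bounded cross theorem for `N` strips, its local form, and the chart lemma in `N` variables

Analysis/Complex support file (everything proved; theorems only, no definitions, no named facts).
The `N`-variable generalisation of `CrossTheoremThreeStrips.lean` (`N = 3`) and of
`LocalCrossTheorem.lean` (`N = 3`), requested by the Euclidean-field-theory consumers which need joint
real-analyticity of an `n`-point function in all `3n` coordinates
(`Summits/CriticalPhenomena/Ising3DConformalLimit`, crux `MoebiusLimitExists`, line `one-map-one-jet`,
stub `stub_nineMirrorAnalyticity`).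

* `differentiableOn_diamond_of_real_params`, `differentiableOn_tube_of_real_params` — **holomorphy in
  a parameter propagates from real points**: if `K ξ η` (`ξ ∈ ℂ`, `η ∈ ℂᴺ`) is holomorphic in `ξ` on
  the strip `{|Im ξ| < b}` at every REAL `η`, and for each such `ξ` jointly holomorphic and bounded in
  `η` on the tube `{Σ |Im η_k| < b - |Im ξ|}`, then `K` is jointly holomorphic on
  `{|Im ξ| + Σ |Im η_k| < b}` (two-strip cross theorem + identity theorem for `N = 1`; induction on `N`
  with the bounded Osgood lemma `differentiableOn_prod_of_separately_of_norm_le`).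
* `exists_holomorphic_extension_of_separately_fin` / `…_fintype` — **the bounded cross theorem for `N`
  strips** (Bernstein 1912 / Siciak 1969; Jarnicki–Pflug 2011, Ch. 5): a bounded function of `N` real
  variables each of whose one-variable slices (the others real) is the trace of a function holomorphic
  and bounded by `M` on `{|Im| < b}` is the trace of ONE function holomorphic on the tube
  `{Σ_k |Im z_k| < b}` and bounded by `M` there.  Induction on `N` from the two-strip theorem
  `exists_holomorphic_extension_diamond_of_separately`: the first-variable slice extensions evaluated at
  a complex `ξ` form a function of `N - 1` real variables with the hypotheses on the strip of width
  `b - |Im ξ|` (two-strip theorem in (first, `k`-th) variable + identity theorem), extended by the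
  induction hypothesis; joint holomorphy by the first bullet.
* `exists_holomorphic_extension_of_separately_local_fintype` — **the local cross theorem in `N`
  variables**: discs of radius `ℓ` for the slices ⇒ one holomorphic function on the polydisc of radius
  `r(ℓ, N)` (reparametrise each variable by `ℓ tanh(·/2)`, apply the strip theorem with `b = π/2`, pull
  back by `2 artanh(·/ℓ)` keeping each angle below `π/(2(N+1))`, `exists_radius_logCayleyInv_lt`).
* `analyticAt_of_holomorphic_chart_fintype` — the chart lemma of `LocalCrossTheorem.lean` for a basis
  indexed by an arbitrary finite type (Osgood, restriction of scalars, affine chart, real parts).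

The hypothesis `∀ x, ‖F x‖ ≤ M` of the strip theorem is implied by the slice data when `N ≥ 1` and is
what makes the statement correct for `N = 0`.

## References

* M. Jarnicki, P. Pflug, *Separately Analytic Functions*, EMS Tracts in Mathematics 16 (2011),
  Ch. 5 (classical cross theorem with estimate; `N`-fold crosses). [JarnickiPflug2011]
* S. N. Bernstein, Mém. Acad. Roy. Belgique (1912); J. Siciak, *Separately analytic functions and
  envelopes of holomorphy of some lower dimensional subsets of `ℂⁿ`*, Ann. Polon. Math. 22 (1969).
* L. Hörmander, *An Introduction to Complex Analysis in Several Variables* (1973), §2.2 (Osgood).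
-/

noncomputable section

open _root_.Complex Set Filter Metric
open scoped _root_.Topology BigOperators

namespace Literature.Analysis.Complex

/-! ### The `N`-fold bounded cross theorem for strips -/

/-- **Holomorphy in a parameter propagates from real points (two variables).** If `K ξ ζ` is
holomorphic in `ξ` on the strip `{|Im ξ| < b}` for every REAL `ζ = t`, and for every `ξ` in that
strip holomorphic and bounded by `M` in `ζ` on the strip `{|Im ζ| < b - |Im ξ|}`, then `K` is jointly
holomorphic on the diamond `{|Im ξ| + |Im ζ| < b}` (the two-strip cross theorem gives a joint
extension of the real cross, which coincides with `K` by the identity theorem on strips, twice).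
[cite: JarnickiPflug2011, Ch. 5 (classical cross theorem with estimate)] -/
theorem differentiableOn_diamond_of_real_params {b M : ℝ} {K : ℂ → ℂ → ℂ}
    (h1 : ∀ t : ℝ, DifferentiableOn ℂ (fun ξ => K ξ t) {ξ : ℂ | |ξ.im| < b})
    (h2 : ∀ ξ : ℂ, |ξ.im| < b →
      DifferentiableOn ℂ (fun ζ => K ξ ζ) {ζ : ℂ | |ζ.im| < b - |ξ.im|} ∧
      ∀ ζ : ℂ, |ζ.im| < b - |ξ.im| → ‖K ξ ζ‖ ≤ M) :
    DifferentiableOn ℂ (fun p : ℂ × ℂ => K p.1 p.2) {p : ℂ × ℂ | |p.1.im| + |p.2.im| < b} := by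
  rcases le_or_gt b 0 with hb | hb
  · have he : {p : ℂ × ℂ | |p.1.im| + |p.2.im| < b} = ∅ := by
      ext p
      simp only [mem_setOf_eq, mem_empty_iff_false, iff_false, not_lt]
      linarith [abs_nonneg p.1.im, abs_nonneg p.2.im]
    rw [he]
    exact differentiableOn_empty
  have hreal : ∀ s : ℝ, |(s : ℂ).im| < b := fun s => by simpa using hb
  obtain ⟨G, hGd, -, hGr⟩ := exists_holomorphic_extension_diamond_of_separately hb
    (F := fun s t : ℝ => K s t) (M := M)
    (fun t => ⟨fun ξ => K ξ t, h1 t, fun ξ hξ => (h2 ξ hξ).2 t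
      (by rw [Complex.ofReal_im, abs_zero]; linarith), fun s => rfl⟩)
    (fun s => ⟨fun ζ => K s ζ, by
      have h := (h2 s (hreal s)).1
      rwa [sub_abs_ofReal_im] at h, fun ζ hζ => (h2 s (hreal s)).2 ζ
      (by rwa [sub_abs_ofReal_im]), fun t => rfl⟩)
  refine hGd.congr fun p hp => ?_
  simp only [mem_setOf_eq] at hp
  have hξ : |p.1.im| < b := by linarith [abs_nonneg p.2.im]
  have hA : ∀ (t : ℝ) (ξ : ℂ), |ξ.im| < b → G (ξ, t) = K ξ t := fun t => by
    have hd := differentiableOn_diamond_slice_fst hGd (t : ℂ)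
    rw [sub_abs_ofReal_im] at hd
    exact eqOn_setOf_abs_im_lt_of_forall_ofReal hb hd (h1 t) (fun s => hGr s t)
  have hd1 := differentiableOn_diamond_slice_snd hGd p.1
  have hB := eqOn_setOf_abs_im_lt_of_forall_ofReal (sub_pos.2 hξ) hd1 (h2 p.1 hξ).1
    (fun t => hA t p.1 hξ)
  exact (hB (show |p.2.im| < b - |p.1.im| by linarith)).symm

/-- `Fin.cons` is differentiable in its head. [folklore] -/
theorem differentiable_finCons_head {N : ℕ} (η' : Fin N → ℂ) :
    Differentiable ℂ (fun η₀ : ℂ => (Fin.cons η₀ η' : Fin (N + 1) → ℂ)) := by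
  refine differentiable_pi.2 fun k => ?_
  refine Fin.cases ?_ (fun j => ?_) k
  · simp only [Fin.cons_zero]
    exact differentiable_id
  · simp only [Fin.cons_succ]
    exact differentiable_const _

/-- `Fin.cons` is differentiable in its tail. [folklore] -/
theorem differentiable_finCons_tail {N : ℕ} (η₀ : ℂ) :
    Differentiable ℂ (fun η' : Fin N → ℂ => (Fin.cons η₀ η' : Fin (N + 1) → ℂ)) := by
  refine differentiable_pi.2 fun k => ?_
  refine Fin.cases ?_ (fun j => ?_) k
  · simp only [Fin.cons_zero]
    exact differentiable_const _
  · simp only [Fin.cons_succ]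
    exact differentiable_apply j

/-- The imaginary-part sum of `Fin.cons η₀ η'`. [folklore] -/
theorem sum_abs_im_cons {N : ℕ} (η₀ : ℂ) (η' : Fin N → ℂ) :
    ∑ k, |((Fin.cons η₀ η' : Fin (N + 1) → ℂ) k).im| = |η₀.im| + ∑ k, |(η' k).im| := by
  rw [Fin.sum_univ_succ]
  simp only [Fin.cons_zero, Fin.cons_succ]

/-- Real points commute with `Fin.cons`. [folklore] -/
theorem ofReal_cons {N : ℕ} (t : ℝ) (y : Fin N → ℝ) :
    (fun k => (((Fin.cons t y : Fin (N + 1) → ℝ) k : ℝ) : ℂ)) =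
      Fin.cons (t : ℂ) (fun k => (y k : ℂ)) := by
  funext k
  refine Fin.cases ?_ (fun j => ?_) k
  · simp only [Fin.cons_zero]
  · simp only [Fin.cons_succ]

/-- **Holomorphy in a parameter propagates from real points (one variable + a block of `N`).**
If `K ξ η` (`ξ ∈ ℂ`, `η ∈ ℂᴺ`) is holomorphic in `ξ` on the strip `{|Im ξ| < b}` at every REAL
`η`, and for every such `ξ` jointly holomorphic and bounded by `M` in `η` on the tube
`{Σ |Im η_k| < b - |Im ξ|}`, then `K` is jointly holomorphic on the tube
`{|Im ξ| + Σ |Im η_k| < b}` (induction on `N`: bounded Osgood lemma in the first block variable,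
the two-variable case for the parameter). [cite: JarnickiPflug2011, Ch. 5 (classical cross theorem with estimate)] -/
theorem differentiableOn_tube_of_real_params : ∀ (N : ℕ) {b M : ℝ} (K : ℂ → (Fin N → ℂ) → ℂ),
    (∀ y : Fin N → ℝ, DifferentiableOn ℂ (fun ξ => K ξ (fun k => (y k : ℂ))) {ξ : ℂ | |ξ.im| < b}) →
    (∀ ξ : ℂ, |ξ.im| < b →
      DifferentiableOn ℂ (K ξ) {η : Fin N → ℂ | ∑ k, |(η k).im| < b - |ξ.im|} ∧
      ∀ η : Fin N → ℂ, ∑ k, |(η k).im| < b - |ξ.im| → ‖K ξ η‖ ≤ M) →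
    DifferentiableOn ℂ (fun p : ℂ × (Fin N → ℂ) => K p.1 p.2)
      {p | |p.1.im| + ∑ k, |(p.2 k).im| < b}
  | 0, b, M, K, h1, _ => by
    have hU : {p : ℂ × (Fin 0 → ℂ) | |p.1.im| + ∑ k, |(p.2 k).im| < b} = {p | |p.1.im| < b} := by
      ext p
      simp
    rw [hU]
    set y₀ : Fin 0 → ℝ := fun k => k.elim0 with hy₀
    have h : DifferentiableOn ℂ (fun p : ℂ × (Fin 0 → ℂ) => K p.1 (fun k => (y₀ k : ℂ)))
        {p | |p.1.im| < b} := (h1 y₀).comp differentiableOn_fst fun p hp => hp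
    exact h.congr fun p _ => congrArg (K p.1) (Subsingleton.elim _ _)
  | N + 1, b, M, K, h1, h2 => by
    -- the shuffled function `g (η₀, (ξ, η')) = K ξ (η₀ :: η')`
    set g : ℂ × (ℂ × (Fin N → ℂ)) → ℂ := fun q => K q.2.1 (Fin.cons q.1 q.2.2) with hg
    set U' : Set (ℂ × (ℂ × (Fin N → ℂ))) :=
      {q | |q.1.im| + (|q.2.1.im| + ∑ k, |(q.2.2 k).im|) < b} with hU'
    have hU'o : IsOpen U' := by
      refine isOpen_lt ?_ continuous_const
      fun_prop
    have hgU' : DifferentiableOn ℂ g U' := by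
      refine differentiableOn_prod_of_separately_of_norm_le hU'o (M := M) (fun q hq => ?_)
        (fun p => ?_) (fun η₀ => ?_)
      · -- the bound
        simp only [hU', mem_setOf_eq] at hq
        have hξ : |q.2.1.im| < b := by
          linarith [abs_nonneg q.1.im, Finset.sum_nonneg (fun k (_ : k ∈ Finset.univ) =>
            abs_nonneg ((q.2.2 k).im))]
        refine (h2 q.2.1 hξ).2 _ ?_
        rw [sum_abs_im_cons]
        linarith
      · -- the first variable `η₀` for fixed `(ξ, η')`
        by_cases hξ : |p.1.im| < b
        · have hd := (h2 p.1 hξ).1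
          refine (hd.comp (differentiable_finCons_head p.2).differentiableOn fun η₀ hη₀ => ?_)
          simp only [hU', mem_setOf_eq] at hη₀ ⊢
          rw [sum_abs_im_cons]
          linarith
        · have he : {η₀ : ℂ | (η₀, p) ∈ U'} = ∅ := by
            ext η₀
            simp only [hU', mem_setOf_eq, mem_empty_iff_false, iff_false, not_lt]
            linarith [abs_nonneg η₀.im, not_lt.1 hξ, Finset.sum_nonneg
              (fun k (_ : k ∈ Finset.univ) => abs_nonneg ((p.2 k).im))]
          rw [he]
          exact differentiableOn_empty
      · -- the block `(ξ, η')` for fixed `η₀`: induction hypothesis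
        have h1' : ∀ y' : Fin N → ℝ, DifferentiableOn ℂ
            (fun ξ => K ξ (Fin.cons η₀ (fun k => (y' k : ℂ)))) {ξ : ℂ | |ξ.im| < b - |η₀.im|} := by
          intro y'
          have h2v := differentiableOn_diamond_of_real_params (b := b) (M := M)
            (K := fun ξ ζ => K ξ (Fin.cons ζ (fun k => (y' k : ℂ)))) (fun t => ?_) (fun ξ hξ => ?_)
          · exact differentiableOn_diamond_slice_fst h2v η₀
          · have h := h1 (Fin.cons t y')
            rwa [ofReal_cons] at h
          · refine ⟨(h2 ξ hξ).1.comp (differentiable_finCons_head _).differentiableOn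
              fun ζ hζ => ?_, fun ζ hζ => (h2 ξ hξ).2 _ ?_⟩
            · simp only [mem_setOf_eq] at hζ ⊢
              rw [sum_abs_im_cons]
              simpa using hζ
            · rw [sum_abs_im_cons]
              simpa using hζ
        have h2' : ∀ ξ : ℂ, |ξ.im| < b - |η₀.im| →
            DifferentiableOn ℂ (fun η' => K ξ (Fin.cons η₀ η'))
              {η' : Fin N → ℂ | ∑ k, |(η' k).im| < b - |η₀.im| - |ξ.im|} ∧
            ∀ η' : Fin N → ℂ, ∑ k, |(η' k).im| < b - |η₀.im| - |ξ.im| →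
              ‖K ξ (Fin.cons η₀ η')‖ ≤ M := by
          intro ξ hξ
          have hξb : |ξ.im| < b := by linarith [abs_nonneg η₀.im]
          refine ⟨(h2 ξ hξb).1.comp (differentiable_finCons_tail η₀).differentiableOn
            fun η' hη' => ?_, fun η' hη' => (h2 ξ hξb).2 _ ?_⟩
          · simp only [mem_setOf_eq] at hη' ⊢
            rw [sum_abs_im_cons]
            linarith
          · rw [sum_abs_im_cons]
            linarith
        have ih := differentiableOn_tube_of_real_params N (b := b - |η₀.im|) (M := M)
          (fun ξ η' => K ξ (Fin.cons η₀ η')) h1' h2'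
        have he : {p : ℂ × (Fin N → ℂ) | (η₀, p) ∈ U'} =
            {p | |p.1.im| + ∑ k, |(p.2 k).im| < b - |η₀.im|} := by
          ext p
          simp only [hU', mem_setOf_eq]
          constructor <;> intro h <;> linarith
        rw [he]
        exact ih
    -- back to the original coordinates
    have hφ1 : Differentiable ℂ (fun p : ℂ × (Fin (N + 1) → ℂ) => p.2 0) :=
      differentiable_pi.1 differentiable_snd 0
    have hφ2 : Differentiable ℂ (fun p : ℂ × (Fin (N + 1) → ℂ) => Fin.tail p.2) :=
      differentiable_pi.2 fun k => differentiable_pi.1 differentiable_snd k.succ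
    have hφ3 : Differentiable ℂ (fun p : ℂ × (Fin (N + 1) → ℂ) => (p.1, Fin.tail p.2)) :=
      differentiable_fst.prodMk hφ2
    have hφ : Differentiable ℂ (fun p : ℂ × (Fin (N + 1) → ℂ) => (p.2 0, (p.1, Fin.tail p.2))) :=
      hφ1.prodMk hφ3
    refine (hgU'.comp hφ.differentiableOn fun p hp => ?_).congr fun p _ => ?_
    · simp only [hU', mem_setOf_eq] at hp ⊢
      rw [Fin.sum_univ_succ] at hp
      have ht : ∑ x, |(Fin.tail p.2 x).im| = ∑ i : Fin N, |(p.2 i.succ).im| := rfl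
      rw [ht]
      linarith
    · simp only [hg, Function.comp_apply, Fin.cons_self_tail]

/-- **The `N`-fold bounded cross theorem for strips** (Bernstein 1912 / Siciak 1969; Jarnicki–Pflug
2011, Ch. 5, `N`-fold cross with estimate): a bounded function `F` of `N` real variables each of whose
one-variable slices (all other variables real) is the trace of a function holomorphic and bounded by
`M` on the strip `{|Im| < b}` is the trace of ONE function holomorphic on the tube
`{Σ |Im z_k| < b}` and bounded by `M` there. Induction on `N`: the slices in the first variable,
evaluated at a complex point `ξ`, form a function of `N - 1` real variables satisfying the
hypotheses on the strip of width `b - |Im ξ|` (two-strip cross theorem + identity theorem); the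
induction hypothesis extends it; joint holomorphy by `differentiableOn_tube_of_real_params`.
[cite: JarnickiPflug2011, Ch. 5 (classical cross theorem with estimate)] -/
theorem exists_holomorphic_extension_of_separately_fin : ∀ (N : ℕ) {b M : ℝ}
    {F : (Fin N → ℝ) → ℂ}, 0 < b → (∀ x, ‖F x‖ ≤ M) →
    (∀ (k : Fin N) (y : Fin N → ℝ), ∃ g : ℂ → ℂ, DifferentiableOn ℂ g {w : ℂ | |w.im| < b} ∧
      (∀ w : ℂ, |w.im| < b → ‖g w‖ ≤ M) ∧ ∀ t : ℝ, g t = F (Function.update y k t)) →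
    ∃ G : (Fin N → ℂ) → ℂ, DifferentiableOn ℂ G {z | ∑ k, |(z k).im| < b} ∧
      (∀ z : Fin N → ℂ, ∑ k, |(z k).im| < b → ‖G z‖ ≤ M) ∧
      ∀ x : Fin N → ℝ, G (fun k => (x k : ℂ)) = F x
  | 0, b, M, F, _, hF, _ => by
    refine ⟨fun _ => F (fun k => k.elim0), differentiableOn_const _, fun z _ => hF _, fun x => ?_⟩
    exact congrArg F (Subsingleton.elim _ _)
  | N + 1, b, M, F, hb, hF, hs => by
    classical
    -- the slices in the first variable
    have h0 : ∀ y : Fin N → ℝ, ∃ g : ℂ → ℂ, DifferentiableOn ℂ g {w : ℂ | |w.im| < b} ∧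
        (∀ w : ℂ, |w.im| < b → ‖g w‖ ≤ M) ∧ ∀ t : ℝ, g t = F (Fin.cons t y) := by
      intro y
      obtain ⟨g, hgd, hgb, hgr⟩ := hs 0 (Fin.cons 0 y)
      exact ⟨g, hgd, hgb, fun t => by rw [hgr, Fin.update_cons_zero]⟩
    choose g₀ hg₀d hg₀b hg₀r using h0
    -- the diamonds in (first variable, variable `k.succ`)
    have hD : ∀ (k : Fin N) (y : Fin N → ℝ), ∃ D : ℂ × ℂ → ℂ,
        DifferentiableOn ℂ D {p : ℂ × ℂ | |p.1.im| + |p.2.im| < b} ∧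
        (∀ p : ℂ × ℂ, |p.1.im| + |p.2.im| < b → ‖D p‖ ≤ M) ∧
        ∀ s t : ℝ, D ((s : ℂ), (t : ℂ)) = F (Fin.cons s (Function.update y k t)) := by
      intro k y
      refine exists_holomorphic_extension_diamond_of_separately hb
        (F := fun s t => F (Fin.cons s (Function.update y k t)))
        (fun t => ⟨g₀ (Function.update y k t), hg₀d _, hg₀b _, fun s => hg₀r _ s⟩)
        (fun s => ?_)
      obtain ⟨g, hgd, hgb, hgr⟩ := hs k.succ (Fin.cons s y)
      exact ⟨g, hgd, hgb, fun t => by rw [hgr, ← Fin.cons_update]⟩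
    choose D hDd hDb hDr using hD
    have hDg : ∀ (k : Fin N) (y : Fin N → ℝ) (t : ℝ) (ξ : ℂ), |ξ.im| < b →
        D k y (ξ, t) = g₀ (Function.update y k t) ξ := by
      intro k y t ξ hξ
      have hd := differentiableOn_diamond_slice_fst (hDd k y) (t : ℂ)
      rw [sub_abs_ofReal_im] at hd
      exact eqOn_setOf_abs_im_lt_of_forall_ofReal hb hd (hg₀d _) (fun s => by
        show D k y (s, t) = g₀ (Function.update y k t) s
        rw [hDr, hg₀r]) hξ
    -- the induction hypothesis for `y ↦ g₀ y ξ`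
    have hG3 : ∀ ξ : ℂ, ∃ G : (Fin N → ℂ) → ℂ, |ξ.im| < b →
        DifferentiableOn ℂ G {η : Fin N → ℂ | ∑ k, |(η k).im| < b - |ξ.im|} ∧
        (∀ η : Fin N → ℂ, ∑ k, |(η k).im| < b - |ξ.im| → ‖G η‖ ≤ M) ∧
        ∀ y : Fin N → ℝ, G (fun k => (y k : ℂ)) = g₀ y ξ := by
      intro ξ
      by_cases hξ : |ξ.im| < b
      · obtain ⟨G, hG⟩ := exists_holomorphic_extension_of_separately_fin N (sub_pos.2 hξ)
          (F := fun y => g₀ y ξ) (M := M) (fun y => hg₀b y ξ hξ) (fun k y =>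
            ⟨fun τ => D k y (ξ, τ), differentiableOn_diamond_slice_snd (hDd k y) ξ,
              fun τ hτ => hDb k y _ (by simp only; linarith), fun t => hDg k y t ξ hξ⟩)
        exact ⟨G, fun _ => hG⟩
      · exact ⟨fun _ => 0, fun h => absurd h hξ⟩
    choose G₃ hG₃ using hG3
    have hprod : DifferentiableOn ℂ (fun p : ℂ × (Fin N → ℂ) => G₃ p.1 p.2)
        {p | |p.1.im| + ∑ k, |(p.2 k).im| < b} :=
      differentiableOn_tube_of_real_params N (M := M) G₃
        (fun y => (hg₀d y).congr fun ξ hξ => (hG₃ ξ hξ).2.2 y)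
        (fun ξ hξ => ⟨(hG₃ ξ hξ).1, (hG₃ ξ hξ).2.1⟩)
    have hφ : Differentiable ℂ (fun z : Fin (N + 1) → ℂ => (z 0, Fin.tail z)) :=
      (differentiable_apply 0).prodMk (differentiable_pi.2 fun k => differentiable_apply k.succ)
    refine ⟨fun z => G₃ (z 0) (Fin.tail z), hprod.comp hφ.differentiableOn fun z hz => ?_,
      fun z hz => ?_, fun x => ?_⟩
    · simp only [mem_setOf_eq] at hz ⊢
      rw [Fin.sum_univ_succ] at hz
      exact hz
    · rw [Fin.sum_univ_succ] at hz
      have hξ : |(z 0).im| < b := by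
        linarith [Finset.sum_nonneg (fun k (_ : k ∈ Finset.univ) => abs_nonneg ((z (Fin.succ k)).im))]
      exact (hG₃ (z 0) hξ).2.1 _ (by show ∑ k, |(z (Fin.succ k)).im| < b - |(z 0).im|; linarith)
    · show G₃ ((x 0 : ℝ) : ℂ) (fun k => ((Fin.tail x k : ℝ) : ℂ)) = F x
      rw [(hG₃ (x 0) (by simpa using hb)).2.2 (Fin.tail x), hg₀r, Fin.cons_self_tail]

/-- **The `N`-fold bounded cross theorem for strips, arbitrary finite index type.**
[cite: JarnickiPflug2011, Ch. 5 (classical cross theorem with estimate)] -/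
theorem exists_holomorphic_extension_of_separately_fintype {ι : Type*} [Fintype ι] [DecidableEq ι]
    {b M : ℝ} {F : (ι → ℝ) → ℂ} (hb : 0 < b) (hF : ∀ x, ‖F x‖ ≤ M)
    (hs : ∀ (k : ι) (y : ι → ℝ), ∃ g : ℂ → ℂ, DifferentiableOn ℂ g {w : ℂ | |w.im| < b} ∧
      (∀ w : ℂ, |w.im| < b → ‖g w‖ ≤ M) ∧ ∀ t : ℝ, g t = F (Function.update y k t)) :
    ∃ G : (ι → ℂ) → ℂ, DifferentiableOn ℂ G {z | ∑ k, |(z k).im| < b} ∧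
      (∀ z : ι → ℂ, ∑ k, |(z k).im| < b → ‖G z‖ ≤ M) ∧
      ∀ x : ι → ℝ, G (fun k => (x k : ℂ)) = F x := by
  classical
  set e := Fintype.equivFin ι with he
  obtain ⟨G, hGd, hGb, hGr⟩ := exists_holomorphic_extension_of_separately_fin (Fintype.card ι) hb
    (F := fun u : Fin (Fintype.card ι) → ℝ => F (u ∘ e)) (M := M) (fun u => hF _)
    (fun k u => by
      obtain ⟨g, hgd, hgb, hgr⟩ := hs (e.symm k) (u ∘ e)
      refine ⟨g, hgd, hgb, fun t => ?_⟩
      rw [hgr]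
      show F (Function.update (u ∘ ⇑e) (e.symm k) t) = F (Function.update u k t ∘ ⇑e)
      rw [Function.update_comp_equiv u e k t])
  have hL : Differentiable ℂ (fun z : ι → ℂ => fun k => z (e.symm k)) :=
    differentiable_pi.2 fun k => differentiable_apply (e.symm k)
  have hsum : ∀ z : ι → ℂ, ∑ k, |(z (e.symm k)).im| = ∑ k, |(z k).im| := fun z =>
    e.symm.sum_comp (fun k => |(z k).im|)
  refine ⟨fun z => G (fun k => z (e.symm k)), hGd.comp hL.differentiableOn fun z hz => ?_,
    fun z hz => hGb _ ?_, fun x => ?_⟩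
  · simp only [mem_setOf_eq] at hz ⊢
    rwa [hsum]
  · rwa [hsum]
  · show G (fun k => ((x (e.symm k) : ℝ) : ℂ)) = F x
    rw [hGr]
    show F ((x ∘ ⇑e.symm) ∘ ⇑e) = F x
    congr 1
    funext k
    simp


/-! ### The local `N`-fold cross theorem (discs ⇒ polydisc) -/

/-- **The pull-back radius with a prescribed angle**: for `ℓ > 0` and `ε > 0` there is `r > 0`
such that `‖z‖ < r` implies `‖z/ℓ‖ < 1` and `|Im A(z/ℓ)| < ε` for the local inverse
`A(z) = log((1 + z)/(1 - z))` of `tanh(·/2)` (continuity of `A` at `0`, `A 0 = 0`). [folklore] -/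
theorem exists_radius_logCayleyInv_lt (ℓ : ℝ) (hℓ : 0 < ℓ) {ε : ℝ} (hε : 0 < ε) :
    ∃ r > 0, ∀ z : ℂ, ‖z‖ < r →
      ‖z / ℓ‖ < 1 ∧ |(log ((1 + z / ℓ) / (1 - z / ℓ))).im| < ε := by
  have hA0 : ContinuousAt (fun z : ℂ => log ((1 + z) / (1 - z))) 0 :=
    (differentiableAt_logCayleyInv (by simp)).continuousAt
  have hT : {w : ℂ | |w.im| < ε} ∈ 𝓝 (log ((1 + (0 : ℂ)) / (1 - 0))) := by
    refine (isOpen_lt (continuous_abs.comp Complex.continuous_im) continuous_const).mem_nhds ?_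
    simp [hε]
  obtain ⟨r₁, hr₁, hball⟩ := Metric.mem_nhds_iff.1 (hA0.preimage_mem_nhds hT)
  refine ⟨ℓ * min r₁ 1, by positivity, fun z hz => ?_⟩
  have hzl : ‖z / ℓ‖ < min r₁ 1 := by
    rw [norm_div, Complex.norm_real, Real.norm_eq_abs, abs_of_pos hℓ, div_lt_iff₀ hℓ]
    linarith
  refine ⟨hzl.trans_le (min_le_right _ _), ?_⟩
  have : z / ℓ ∈ ball (0 : ℂ) r₁ := by
    rw [mem_ball_zero_iff]; exact hzl.trans_le (min_le_left _ _)
  exact hball this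

/-- **The local real cross theorem in `N` variables** (Bernstein 1912; Siciak 1969; Jarnicki–Pflug
2011, Ch. 5): for every finite index type `ι` and `ℓ > 0` there is `r > 0` (depending on `ℓ` and
`card ι` only) such that every bounded function `P` of the real variables `(t_k)_{k ∈ ι}` on the
cube `(-ℓ, ℓ)^ι` whose slices in each single variable (the others fixed in the cube) are traces of
functions holomorphic on the disc of radius `ℓ` and bounded by `M` there, is on `(-r, r)^ι` the
trace of ONE function holomorphic on the polydisc of radius `r` around `0 ∈ ℂ^ι` and bounded by
`M`. (Reparametrise every variable by `ℓ tanh(·/2)`, apply the `N`-fold cross theorem for strips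
with `b = π/2`, pull back by `2 artanh(·/ℓ)` with angle `< π/(2(N+1))` per variable.)
[cite: JarnickiPflug2011, Ch. 5 (classical cross theorem with estimate)] -/
theorem exists_holomorphic_extension_of_separately_local_fintype {ι : Type*} [Fintype ι]
    [DecidableEq ι] (ℓ : ℝ) (hℓ : 0 < ℓ) :
    ∃ r > 0, ∀ (M : ℝ) (P : (ι → ℝ) → ℂ),
      (∀ x : ι → ℝ, (∀ k, |x k| < ℓ) → ‖P x‖ ≤ M) →
      (∀ (k : ι) (y : ι → ℝ), (∀ j, |y j| < ℓ) → ∃ g : ℂ → ℂ,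
        DifferentiableOn ℂ g (ball (0 : ℂ) ℓ) ∧ (∀ w ∈ ball (0 : ℂ) ℓ, ‖g w‖ ≤ M) ∧
        ∀ t : ℝ, |t| < ℓ → g t = P (Function.update y k t)) →
      ∃ G : (ι → ℂ) → ℂ,
        DifferentiableOn ℂ G {z : ι → ℂ | ∀ k, ‖z k‖ < r} ∧
        (∀ z : ι → ℂ, (∀ k, ‖z k‖ < r) → ‖G z‖ ≤ M) ∧
        ∀ x : ι → ℝ, (∀ k, |x k| < r) → G (fun k => (x k : ℂ)) = P x := by
  have hε : 0 < Real.pi / (2 * ((Fintype.card ι : ℝ) + 1)) := by positivity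
  obtain ⟨r, hr, hrad⟩ := exists_radius_logCayleyInv_lt ℓ hℓ hε
  have hb : (0 : ℝ) < Real.pi / 2 := by positivity
  -- the total angle after pull-back stays below `π/2`
  have hangle : (Fintype.card ι : ℝ) * (Real.pi / (2 * ((Fintype.card ι : ℝ) + 1))) < Real.pi / 2 := by
    have hN1 : (Fintype.card ι : ℝ) + 1 ≠ 0 := by positivity
    have h1 : (Fintype.card ι : ℝ) / ((Fintype.card ι : ℝ) + 1) < 1 :=
      (div_lt_one (by positivity)).2 (by linarith)
    have h2 : (Fintype.card ι : ℝ) * (Real.pi / (2 * ((Fintype.card ι : ℝ) + 1))) =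
        Real.pi / 2 * ((Fintype.card ι : ℝ) / ((Fintype.card ι : ℝ) + 1)) := by
      field_simp
    rw [h2]
    exact mul_lt_of_lt_one_right hb h1
  have hsumA : ∀ z : ι → ℂ, (∀ k, ‖z k‖ < r) →
      ∑ k, |(log ((1 + z k / ℓ) / (1 - z k / ℓ))).im| < Real.pi / 2 := by
    intro z hz
    calc ∑ k, |(log ((1 + z k / ℓ) / (1 - z k / ℓ))).im|
        ≤ ∑ _k : ι, Real.pi / (2 * ((Fintype.card ι : ℝ) + 1)) :=
          Finset.sum_le_sum fun k _ => ((hrad _ (hz k)).2).le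
      _ = (Fintype.card ι : ℝ) * (Real.pi / (2 * ((Fintype.card ι : ℝ) + 1))) := by
          rw [Finset.sum_const, Finset.card_univ, nsmul_eq_mul]
      _ < Real.pi / 2 := hangle
  refine ⟨r, hr, fun M P hP h1 => ?_⟩
  -- the real reparametrisation
  set ψr : ℝ → ℝ := fun u => ℓ * ((Real.exp u - 1) / (Real.exp u + 1)) with hψr
  have hψr_lt : ∀ u : ℝ, |ψr u| < ℓ := fun u => by
    rw [hψr, abs_mul, abs_of_pos hℓ]
    exact mul_lt_of_lt_one_right hℓ (abs_cayleyExp_real_lt_one u)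
  -- the complex reparametrisation maps the strip into the disc of radius ℓ
  set ψc : ℂ → ℂ := fun ζ => (ℓ : ℂ) * ((exp ζ - 1) / (exp ζ + 1)) with hψc
  have hψc_maps : MapsTo ψc {ζ : ℂ | |ζ.im| < Real.pi / 2} (ball (0 : ℂ) ℓ) := fun ζ hζ => by
    rw [mem_ball_zero_iff, hψc, norm_mul, Complex.norm_real, Real.norm_eq_abs, abs_of_pos hℓ]
    exact mul_lt_of_lt_one_right hℓ (norm_cayleyExp_lt_one hζ)
  have hψc_diff : DifferentiableOn ℂ ψc {ζ : ℂ | |ζ.im| < Real.pi / 2} :=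
    differentiableOn_cayleyExp.const_mul _
  have hψc_real : ∀ u : ℝ, ψc u = ((ψr u : ℝ) : ℂ) := fun u => by
    rw [hψc, hψr]; dsimp only; rw [cayleyExp_ofReal]; push_cast; ring
  -- the reparametrised function of `ι` real variables and its strip data
  set F : (ι → ℝ) → ℂ := fun u => P (fun k => ψr (u k)) with hFdef
  obtain ⟨G, hGd, hGb, hGr⟩ := exists_holomorphic_extension_of_separately_fintype hb (F := F)
    (M := M) (fun u => hP _ fun k => hψr_lt _)
    (fun k u => by
      obtain ⟨g, hgd, hgb, hgr⟩ := h1 k (fun j => ψr (u j)) fun j => hψr_lt _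
      refine ⟨fun ζ => g (ψc ζ), hgd.comp hψc_diff hψc_maps, fun w hw => hgb _ (hψc_maps hw),
        fun t => ?_⟩
      show g (ψc t) = P (fun j => ψr (Function.update u k t j))
      rw [hψc_real, hgr _ (hψr_lt t)]
      congr 1
      funext j
      by_cases hj : j = k
      · subst hj
        simp
      · simp [Function.update_of_ne hj])
  -- pull back by the local inverse
  set A : ℂ → ℂ := fun z => log ((1 + z / ℓ) / (1 - z / ℓ)) with hA
  have hA_diff : ∀ z : ℂ, ‖z‖ < r → DifferentiableAt ℂ A z := fun z hz => by
    have h := differentiableAt_logCayleyInv (hrad z hz).1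
    have h2 : DifferentiableAt ℂ (fun z : ℂ => z / (ℓ : ℂ)) z := differentiableAt_id.div_const _
    exact h.comp z h2
  have hA_real : ∀ x : ℝ, |x| < r → A x = ((Real.log ((1 + x / ℓ) / (1 - x / ℓ)) : ℝ) : ℂ) := by
    intro x hx
    have h := (hrad x (by rwa [Complex.norm_real, Real.norm_eq_abs])).1
    rw [← Complex.ofReal_div, Complex.norm_real, Real.norm_eq_abs] at h
    rw [hA]; dsimp only
    rw [← Complex.ofReal_div, logCayleyInv_ofReal h]
  have hψA : ∀ x : ℝ, |x| < r → ψr (Real.log ((1 + x / ℓ) / (1 - x / ℓ))) = x := by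
    intro x hx
    have h := (hrad x (by rwa [Complex.norm_real, Real.norm_eq_abs])).1
    rw [← Complex.ofReal_div, Complex.norm_real, Real.norm_eq_abs] at h
    rw [hψr]; dsimp only
    rw [cayleyExp_logCayleyInv_real h]
    field_simp
  refine ⟨fun z => G (fun k => A (z k)), ?_, fun z hz => hGb _ (hsumA z hz), fun x hx => ?_⟩
  · refine hGd.comp (differentiableOn_pi.2 fun k z hz => ?_) fun z hz => hsumA z hz
    have hk : DifferentiableAt ℂ (fun w : ι → ℂ => w k) z := differentiableAt_apply k z
    exact ((hA_diff _ (hz k)).comp z hk).differentiableWithinAt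
  · show G (fun k => A (x k)) = P x
    have hx' : (fun k => A (x k)) = fun k =>
        ((Real.log ((1 + x k / ℓ) / (1 - x k / ℓ)) : ℝ) : ℂ) := funext fun k => hA_real _ (hx k)
    rw [hx', hGr, hFdef]
    dsimp only
    congr 1
    funext k
    exact hψA _ (hx k)

/-! ### From a holomorphic extension near `0 ∈ ℂ^ι` to real analyticity at a point -/

/-- **Chart lemma** (finite index type). Let `b` be a basis of a real normed space `V` indexed
by a finite type `ι`, `f : V → ℝ`, and suppose `t ↦ f (x + Σ_k t_k b_k)` agrees on the cube
`(-r, r)^ι` with a function `G` holomorphic on the polydisc of radius `r` around `0 ∈ ℂ^ι`. Then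
`f` is real-analytic at `x` (Osgood's lemma, restriction of scalars, the real-analytic affine chart
`w ↦ coordinates of w - x`, real parts). [folklore] -/
theorem analyticAt_of_holomorphic_chart_fintype {ι : Type*} [Fintype ι] {V : Type*}
    [NormedAddCommGroup V] [NormedSpace ℝ V] [CompleteSpace V] (b : Module.Basis ι ℝ V)
    {f : V → ℝ} {x : V} {r : ℝ} (hr : 0 < r) {G : (ι → ℂ) → ℂ}
    (hGd : DifferentiableOn ℂ G {z : ι → ℂ | ∀ k, ‖z k‖ < r})
    (hGr : ∀ t : ι → ℝ, (∀ k, |t k| < r) →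
      G (fun k => (t k : ℂ)) = ((f (x + ∑ k, t k • b k) : ℝ) : ℂ)) :
    AnalyticAt ℝ f x := by
  haveI : FiniteDimensional ℝ V := b.finiteDimensional_of_finite
  set φ : V → (ι → ℝ) := fun w => b.equivFun (w - x) with hφ
  have hφ_cont : Continuous φ := b.equivFunL.continuous.comp (continuous_id.sub continuous_const)
  have hφx : φ x = 0 := by simp [hφ]
  have hφ_an : AnalyticAt ℝ φ x :=
    (b.equivFunL.analyticAt _).comp ((analyticAt_id).sub analyticAt_const)
  set L : (ι → ℝ) →L[ℝ] (ι → ℂ) :=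
    ContinuousLinearMap.pi fun k => Complex.ofRealCLM.comp (ContinuousLinearMap.proj k) with hL
  have hLapp : ∀ u : ι → ℝ, L u = fun k => ((u k : ℝ) : ℂ) := fun u => rfl
  set Ψ : V → (ι → ℂ) := fun w => L (φ w) with hΨ
  have hΨ_an : AnalyticAt ℝ Ψ x := (L.analyticAt _).comp hφ_an
  have hΨx : Ψ x = 0 := by
    rw [hΨ]; dsimp only; rw [hφx, map_zero]
  have hU : IsOpen {z : ι → ℂ | ∀ k, ‖z k‖ < r} := by
    rw [Set.setOf_forall]
    exact isOpen_iInter_of_finite fun k => isOpen_lt (continuous_apply k).norm continuous_const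
  have hG_an : AnalyticAt ℂ G (Ψ x) := by
    rw [hΨx]
    exact SCV.analyticAt_of_differentiableOn hGd hU (by simp [hr])
  have hcomp : AnalyticAt ℝ (fun w => (G (Ψ w)).re) x :=
    (Complex.reCLM.analyticAt _).comp ((hG_an.restrictScalars (𝕜 := ℝ)).comp hΨ_an)
  refine hcomp.congr ?_
  have hev : ∀ᶠ w in 𝓝 x, ∀ k, |φ w k| < r := by
    refine Filter.eventually_all.2 fun k => ?_
    have hc : Continuous fun w => |φ w k| :=
      continuous_abs.comp ((continuous_apply k).comp hφ_cont)
    refine hc.continuousAt.eventually_lt continuousAt_const ?_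
    simp [hφx, hr]
  filter_upwards [hev] with w hw
  have hsum : x + ∑ k, φ w k • b k = w := by
    rw [hφ]; dsimp only
    rw [b.sum_equivFun]
    abel
  show (G (L (φ w))).re = f w
  rw [hLapp, hGr _ hw, hsum, Complex.ofReal_re]


end Literature.Analysis.Complex

end
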